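import Summits.RiemannHypothesis.RiemannHypothesis.Theorems.AsymptoticCriticalLine.Negative.BandForms
import Summits.RiemannHypothesis.RiemannHypothesis.Theorems.AsymptoticCriticalLine.Negative.ShapeFails
import Summits.RiemannHypothesis.RiemannHypothesis.Theorems.AsymptoticCriticalLine.Negative.DavenportHeilbronnBand
import Summits.RiemannHypothesis.RiemannHypothesis.Theorems.AsymptoticCriticalLine.Negative.HurwitzShift
import Summits.RiemannHypothesis.RiemannHypothesis.Theorems.AsymptoticCriticalLine.Negative.Ladder
import Summits.RiemannHypothesis.RiemannHypothesis.Theorems.AsymptoticCriticalLine.Negative.KnownEnd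
import Summits.RiemannHypothesis.RiemannHypothesis.Theorems.AsymptoticCriticalLine.Negative.Products
import Summits.RiemannHypothesis.RiemannHypothesis.Theorems.AsymptoticCriticalLine.Negative.ShapeFailsMore
import Summits.RiemannHypothesis.RiemannHypothesis.Theorems.AsymptoticCriticalLine.Negative.Lindelof
-- import Summits.RiemannHypothesis.RiemannHypothesis.Theorems.AsymptoticCriticalLine.Negative.LindelofHolds  -- ACCEPTED (cycle 3) but not yet in the farm build snapshot at cycle 4; re-enable when built
import Summits.RiemannHypothesis.RiemannHypothesis.Theorems.AsymptoticCriticalLine.Negative.Scaling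
import Summits.RiemannHypothesis.RiemannHypothesis.Theorems.AsymptoticCriticalLine.Negative.Split
import Summits.RiemannHypothesis.RiemannHypothesis.Theorems.AsymptoticCriticalLine.Negative.Truncation
import Summits.RiemannHypothesis.RiemannHypothesis.Theorems.AsymptoticCriticalLine.Negative.BeurlingInterior
-- import Summits.RiemannHypothesis.RiemannHypothesis.Theorems.AsymptoticCriticalLine.Negative.SplitWitness  -- ACCEPTED (cycle 3) but not yet in the farm build snapshot at cycle 4; re-enable when built
import Summits.RiemannHypothesis.RiemannHypothesis.Theorems.AsymptoticCriticalLine.Negative.FormsMore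
-- import Summits.RiemannHypothesis.RiemannHypothesis.Theorems.AsymptoticCriticalLine.Negative.StubProfile  -- ACCEPTED (cycle 3) but not yet in the farm build snapshot at cycle 4; re-enable when built
import Literature.Barriers.RiemannHypothesis.LindelofBacklundProofs
import Literature.NumberTheory.LFunctions.FiniteEulerProducts
import Literature.NumberTheory.LFunctions.ZetaArgVariation
import Literature.NumberTheory.LFunctions.ZeroCountingProofs
import Literature.NumberTheory.LFunctions.SelbergZeroDensityNearHalf
import Literature.Analysis.UnboundedOperators.DiagonalOperatorCompact

/-!
# Disproof work file for `AsymptoticCriticalLine` (stmt-RiemannHypothesis-2063, route RuelleBand)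

Standing adversary: refuter-cdisprove-stmt-RiemannHypothesis-2063-0 (cycle 1, 2026-08-16);
refuter-cdisprove-stmt-RiemannHypothesis-2063-g2-0 (cycle 2, 2026-08-16: §5e, §§6–8, imports
`RamanujanAxiomNecessity`, `BohrDenseValuesVoronin`, `ZeroDensityIngham`);
refuter-cdisprove-stmt-RiemannHypothesis-2063-g3-0 (cycle 3, 2026-08-16: §§9–11, imports
`LindelofBacklund`, `ZeroCounting`; Negative/ files `Lindelof`, `Scaling`, `Split`);
refuter-cdisprove-stmt-RiemannHypothesis-2063-g4-0 (cycle 4, 2026-08-16: §§14–16, imports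
`FiniteEulerProducts`, `ZetaArgVariation`, `ZeroCountingProofs`, `DiagonalOperatorCompact`;
Negative/ files `Periodic`, `AlmostAll`, `EngineSharp`).

LAYOUT SINCE CYCLE 4 (crux workfiles are capped at 200 000 bytes; the full file had reached
228 KB; its last full in-file text is commit f85e597d9a58 of this directory, 2026-08-16T04:16Z): the Lean text of §§0–13 (cycles 1–3) now lives ONLY in the LANDED, importable modules
`Theorems/AsymptoticCriticalLine/Negative/*.lean` (all ACCEPTED; imported below): cycle 1
`BandForms` (§§0–4), `ShapeFails` (§5a–c), `DavenportHeilbronnBand` (§5d) (p73824/p73835/p73848);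
cycle 2 `HurwitzShift` (§5e, p76284), `Ladder` (§6a–d, §8; p75730), `KnownEnd` (§6e, p75998),
`Products` (§6f, p76416), `ShapeFailsMore` (§7a–c, p75721); cycle 3 `Lindelof` + `LindelofHolds`
(§9; p77288, p78196), `Scaling` (§10, p77304), `Split` (§11a, p77335), `Truncation` (§11b, p77342),
`BeurlingInterior` (§11c, p77872), `SplitWitness` (§11, p78154), `FormsMore` (§12, p77353),
`StubProfile` (§13, p78497). NAME MAP (historical name in this index → landed name, where they
differ; all other names are identical): `acl_iff_asymptoticBand → acl_iff_bandSet` (kept below as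
an alias), `asymptoticBand_iff_small/nat → acl_iff_small/nat`, `aclWithoutReLtOne_iff →
acl_iff_without_reLtOne`, `asymptoticBand_zeta_of_riemannHypothesis →
bandSet_eq_empty_of_riemannHypothesis`, `not_asymptoticBand_<obj> → not_band_<obj>` and
`exists_beurling_not_asymptoticBand → exists_beurling_not_band` (the shape `AsymptoticBand Z` is
written out as `∀ ε > 0, (bandSet Z ε).Finite`; `ShapeFails` calls the band set `shapeBand`),
`PowerSumShape / powerSumShape_zero_iff / powerSumShape_mono / asymptoticBand_of_powerSumShape /
acl_of_powerSumRung / powerSumRung_of_cofinite / not_powerSumRung_of_not_acl /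
not_forall_powerSumShape_imp_finite / not_forall_heightSumShape_imp_band → powerSum_bounded_zero_iff /
powerSum_bounded_mono / band_finite_of_powerSum_bounded / acl_of_powerSum_bounded /
powerSum_bounded_of_cofinite / not_powerSum_bounded_of_not_acl / not_forall_powerSum_imp_finite /
not_forall_heightSum_imp_band`, `asymptoticBand_mul_iff / asymptoticBand_congr → band_mul_iff /
band_congr`, §13 `StubNoRightInteriorBand ↔ … → rightInteriorShape_zeta_iff, stub1_iff_*`
(`targets_summary` = the conjunction of the `StubProfile` theorems). This file keeps (i) this
INDEX of all findings, (ii) aliases of the headline theorems under their historical names (§A),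
and (iii) the full Lean text of the newest cycle (currently §§14–16, LANDED as Negative/`Periodic`
p81379, `AlmostAll` p81473, `EngineSharp` p81557 — all ACCEPTED 2026-08-16T05:2xZ; their text stays
here, with explicit-list `open`s so no name becomes ambiguous, until the farm build contains the
modules); PROTOCOL for later seats: once a section's Negative/ file is accepted, collapse
its text here to aliases/imports and extend the index — never drop a finding from the index.
Crux (RuelleBand.lean): `∀ ε > 0, {s | ζ s = 0 ∧ 0 < Re s ∧ Re s < 1 ∧ ε ≤ |Re s − 1/2|}.Finite`
("`Θ_ess = 1/2`": every band off the critical line is finite). Everything below and everything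
landed is `sorry`-free, axioms `propext / Classical.choice / Quot.sound`.

## Bottom line after four cycles (read this first)

NO KILL EXISTS short of `¬RH` (`RH ⟹ crux`, §4; RH verified to height `3·10¹²`). COST FLOOR: the
crux implies Backlund's zero condition (PROVED, §9), hence the LINDELÖF hypothesis (Titchmarsh's
Theorem 13.5 is PROVED in tree) and the DENSITY hypothesis, all unconditionally — a
BandRealisation proving rung #4 contains a proof of Lindelöf. PROFILE of any proof (each item below is a checked theorem showing
the band shape FAILS when that input is relaxed): every local Euler factor tempered (§5a) AND the
weights of all iterates exact (§10: `ζ(s)ζ(2s)` is a tempered degree-3 Euler product with a second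
band at `1/4`); exact half-density normalisation / functional equation `s ↔ 1 − s` with no width
(§7a, §10); the complete series, no truncation (§11b: `1 + 2^{−s} + 3^{−s}` has an interior band);
non-additive in the `L`-function (§5b, d, e); value-`0`-specific (§7b); not inherited by `ζ'` (§7c);
more of `ℤ` than multiplicativity + `N(x) = Ax + O(x^θ)` for any `θ ≥ 1/2` — for the EDGE half by
DMV 2006 (§5c) and for the INTERIOR half by Broucke 2024 Thm 6.3 (§11c); not a height-summability
or density statement (§6d–e, §9). The two halves of the crux (interior band / edge strip, card
interior-edge-split) are independent (§11: unconditional witness `ζ₃`), and the interior half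
alone already needs every exactness input above. Cycle 4 adds three LOCATORS: the slack of the crux
below RH is an aperiodic (archimedean, infinite-product) phenomenon — on every vertically periodic
model (function fields, single Euler factors, finite Euler products) rung #4 ⟺ #5 ⟺ "no off-line
zero" (§14); the density-one version of the crux is a THEOREM (proportion of band zeros
`O(T^{−2ε/(3−2ε)}) → 0`, Ingham + Riemann–von Mangoldt, §15); and the route's engine ("unitary +
compact at one time") outputs exactly rung #4 — a diagonal group on `ℓ²` satisfies its hypotheses
at every time with infinitely many off-line joint eigenvalues accumulating at the line (§16).

## Findings (numbers, not adjectives)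

* READ-BACK. Probe rc 0; `1 / 2 : ℝ`; no junk operators, no coercion traps; the set-builder is
  literally `bandSet riemannZeta ε` (`acl_iff_asymptoticBand` is `Iff.rfl`). For `ε ≥ 1/2` the
  band set of ANY function is empty (`bandSet_eq_empty_of_half_le`): the crux has content exactly
  for `0 < ε < 1/2`, and by antitonicity only along `ε = 1/(n+1)` (`asymptoticBand_iff_small`,
  `asymptoticBand_iff_nat`).
* NO KILL, and none exists short of a disproof of RH: `RiemannHypothesis → bandSet ζ ε = ∅` for
  every `ε > 0` (`bandSet_eq_empty_of_riemannHypothesis`, `asymptoticBand_zeta_of_riemannHypothesis`).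
  KILL SHAPE `not_acl_iff`: one level `ε > 0` carrying infinitely many zeros ("a second band");
  by `bandSet_finite_iff_bounded` / `acl_iff_height` equivalently a sequence of zeros with
  `|Im ρ_n| → ∞` and `|Re ρ_n − 1/2| ≥ ε`. Numerics cannot supply it: RH is verified for all zeros
  with `0 < γ ≤ 3·10¹²` (Platt–Trudgian 2021, Bull. LMS 53), so every band set is empty below that
  height; above it zero-density estimates (`N(σ,T) ≪ T^{1−(σ−1/2)/4} log T`, Selberg 1946) make the
  level-`ε` band a vanishing proportion of the zeros but never finite (route's own barrier
  `Literature.Barriers.RiemannHypothesis.LindelofBacklund`: even Lindelöf gives only `o(log T)` per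
  unit window). No printed claim of infinitely many off-line zeros of `ζ` exists.
* LOAD-BEARING ANALYSIS (§2), one clause dropped at a time:
  - `0 < Re s` — FALSE without it: `acl_false_without_rePos` (trivial zeros `−2(n+1)`, level `1`);
    also with both strip clauses dropped, `acl_false_without_strip`;
  - `0 < ε` — FALSE at level `0`: `acl_false_without_epsPos` (Hardy's infinitely many critical
    zeros, PROVED in tree `hardy_infinite_zeros_on_critical_line_holds`);
  - `riemannZeta s = 0` — FALSE: `acl_false_without_zero` (the line `Re s = 3/4`);
  - `Re s < 1` — REDUNDANT: `aclWithoutReLtOne_iff` (Mathlib `riemannZeta_ne_zero_of_one_le_re`).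
* NO PARTIAL CREDIT (§3 `eventually_zeroFree_of_bandSet_finite`): finiteness of a single band of
  level `ε < 1/2` is an eventual quasi-RH on `Re s ≥ 1/2 + ε` — each instance of the crux is open.
* EQUIVALENT FORMS for the prover (§3): ONE-SIDED `acl_iff_rightBand` (finiteness of
  `{ζ = 0, 1/2 + ε ≤ Re s < 1}` suffices, by `ρ ↦ 1 − ρ`, `riemannZeta_one_sub_eq_zero`) — the
  route's "one-sided suffices"; HEIGHT form `acl_iff_height`; NON-TRIVIAL-ZERO form
  `acl_iff_nontrivial` (Mathlib's `RiemannHypothesis` convention); rung #5 `CofiniteCriticalLine`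
  = finiteness of the union of all bands (`cofinite_iff_iUnion_bandSet`).
* THE SHAPE FAILS FOR `ζ`-LIKE OBJECTS (§5) — refuted strengthenings / barrier reductions; a proof
  of the crux must use an input that each object lacks:
  (a) `not_asymptoticBand_zetaTwistedAtTwo` (UNCONDITIONAL): `(1 − 2^{3/4−s}) ζ(s)` — multiplicative
      coefficients, Euler product over all primes, ONE non-tempered factor — has the whole line
      `{3/4 + 2πik/log 2 : k ∈ ℕ}` inside its level-`1/4` band. So temperedness of EVERY local
      factor is used (the Selberg-class axiom `θ < 1/2`; in the route's dictionary: the exact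
      half-density weight `log p · p^{−k/2}` at every periodic orbit — one rough orbit = one full
      second band).
  (b) `not_asymptoticBand_swF` (UNCONDITIONAL, from the tree's PROVED Saias–Weingartner 2009 Thm 2,
      `Literature.Barriers.RiemannHypothesis.SaiasWeingartner_holds`): `L(s,χ₃) + L(s,χ₅)`
      (quadratic characters mod 3 and 5) has `≥ cT` zeros with `3/4 < Re s < 1`, `|Im s| ≤ T`, for
      all large `T`. The band property is NOT additive and not a property of "Dirichlet series with
      periodic coefficients + continuation + finite order + mean values": the Euler product of `ζ`
      itself must enter (barrier `DavenportHeilbronnNarrow`).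
  (d) `not_asymptoticBand_davenportHeilbronn` (UNCONDITIONAL): the Davenport–Heilbronn function
      `f` itself (entire, `5`-periodic coefficients, Riemann-type odd functional equation of
      conductor `5`, infinitely many zeros ON the line — tree
      `davenportHeilbronn_zeros_on_critical_line_infinite`) has `≥ cT` zeros with `3/4 < Re s < 1`:
      via `f = c·L(·,χ₁) + c̄·L(·,χ̄₁)` (`davenportHeilbronn_eq_comb`, `chi1Char`) and
      `SaiasWeingartner_holds`. Functional equation + critical zeros do not give the band either.
  (c) `exists_beurling_not_asymptoticBand` (modulo the catalogued named fact
      `DiamondMontgomeryVorhauer2006_thm1`): a Beurling prime system with `N(x) = κx + O(x^{3/4})`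
      whose continued zeta function has infinitely many zeros on `σ = 1 − 2/log t` — a band whose
      real parts ACCUMULATE AT 1. Landau–Beurling methods (multiplicativity + integer count with
      `θ > 1/2`, barrier `BeurlingCounterexamples`) cannot prove the crux, which sits strictly above
      quasi-RH (support `AsymptoticToZeroFreeStrip`), itself already blocked for them.
* WHY IT RESISTS (for the provers). RH-implied, open, strictly above every zero-free region in
  print (all of width `→ 0`). (a)–(d) profile any proof: sensitive to each local factor,
  non-additive in the `L`-function, using more of `ℤ` than `N(x) = κx + O(x^θ)` — i.e. exactly an
  Euler-product / trace-formula argument with exact weights, consistent with the route's plan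
  (a-priori Lasota–Yorke for Meyer's `π₋`) and with its kill criterion (ii); nothing cheaper is
  visible from the negative side.

## Cycle 2 findings (§§6–8; all `sorry`-free, axioms `propext / Classical.choice / Quot.sound`)

* LADDER CALCULUS (§6). `acl_iff_strict`. QUANTIFIER SWAP `cofinite_iff_exists_forall`: the crux
  is `∀ ε ∃ T` (`acl_iff_height`), rung #5 is literally `∃ T ∀ ε`. POWER-SUM ("Schatten-`k`")
  RUNGS `PowerSumShape Z k` = `∑_{ρ off-line} |Re ρ − 1/2|^k < ∞` (the rungs of the crux-ideate
  card schatten-defect-weyl-majorant): `k = 0` IS #5 (`powerSumShape_zero_iff`), monotone in `k`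
  (`powerSumShape_mono`), each rung ⇒ crux (`asymptoticBand_of_powerSumShape`,
  `acl_of_powerSumRung`), #5 ⇒ all (`powerSumRung_of_cofinite`). KILL PROPAGATION (§6c): a
  second band kills every power-sum rung, #5, X and Mathlib's `RiemannHypothesis`
  (`not_riemannHypothesis_of_not_acl`). WHAT DOES NOT REACH (§6d, abstract zero sets): all rungs
  `k ≥ 1` together ⇏ #5 (`not_forall_powerSumShape_imp_finite`, zero set
  `1/2 + 2^{−(n+2)} + in`) — a Schatten Gram defect of any exponent is no route to FIN; and all
  HEIGHT sums `∑_{band} (1+|γ|)^{−θ} < ∞`, `θ > 0`, together ⇏ crux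
  (`not_forall_heightSumShape_imp_band`, zero set `3/4 + i2^n`): the θ-ladder (whose rungs
  `θ > 1 − 4ε/(3−2ε)` are theorems by Ingham/Selberg density, tree `zeroDensity_ingham_holds`,
  `selberg_zeroDensity_near_half`) is disconnected from its endpoint `θ = 0` = crux. This is the
  formal core of barrier `LindelofBacklund` here: density/summability in the height never gives
  finiteness. In the tree's counting currency (§6e): KNOWN `N(1/2+ε, T) = O(T^{1−2ε/(3−2ε)})`
  (`countRe_isBigO_of_ingham`, from `zeroDensity_ingham_holds`) versus CRUX `N(1/2+ε, T) = O(1)`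
  (`countRe_bounded_of_acl`); nothing in between is known for `ζ`.
* PRODUCT CALCULUS / COMPLETED FORM (§6f): bands of a product are unions (`bandSet_mul`,
  `asymptoticBand_mul_iff`): the shape is INHERITED BY FACTORS (prove it for any function divisible
  by `ζ` in the strip — a Dedekind `ζ_K`, the construction over a finite extension — and the crux
  follows) and only sees the strip zero set (`asymptoticBand_congr`); crux ⟺ band shape of
  Mathlib's `completedRiemannZeta` (`acl_iff_completedRiemannZeta`).
* ADDITIVE SHIFT (§5e, unconditional, via the tree's PROVED `SaiasWeingartner_holds`): Mathlib's
  Hurwitz zeta function `ζ(s, 1/5)` (`hurwitzFifth`; `ζ = ζ(s, 0)` is in the same family) has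
  `≥ cT` zeros with `3/4 < Re s < 1` (`not_asymptoticBand_hurwitzFifth`; Voronin 1976 / Gonek
  1979), through the identity `∑_{χ mod 5} L(s, χ) = 4·5^{−s} ζ(s, 1/5)` (`sum_LFunction_five`,
  `hw_sum_eq`, from Mathlib's `ZMod.LFunction`). Additive shifts of the Dirichlet series destroy
  the band; in `{ζ(s, a) : a ∈ ℚ/ℤ}` the shape is possible at most for `a ∈ {0, 1/2}`.
* THE BAND WITH A WIDTH (§7a, unconditional, Hardy via the PROVED barrier file
  `RamanujanAxiomNecessity`): `G_a = ζ(s−a)ζ(s+a)`, `0 < a < 1/2` — degree-2 Euler product over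
  all primes, Selberg `θ = a < 1/2` Euler axiom satisfied, EXACT functional equation
  `Λ_a(s) = Λ_a(1−s)` — has an infinite band at level `a`: BOTH lines `Re s = 1/2 ± a`
  (`not_asymptoticBand_shiftedZeta`). Dictionary: potential off half-density by `±a` ⇒ the band
  edges separate, `γ₀⁻ = 1/2 − a < γ₀⁺ = 1/2 + a`, both populated — Faure–Tsujii's general shape
  `{|Re z| ≤ τ}`. Above width `a`, `G_a` has exactly `ζ`'s bands (`bandSet_shiftedZeta_subset`),
  and `acl_iff_forall_shiftedZeta`: the crux ⟺ "for every `a`, all bands of `G_a` of level `> a`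
  are finite". A band theorem that comes with a width parameter (unequal min/max expansion) is,
  on this family, exactly as strong as the crux; the crux is its width-`0` case and nothing less.
* THE VALUE `0` IS SPECIAL (§7b, unconditional, Titchmarsh §11.10 PROVED in tree as
  `Titchmarsh1986_aPoints_holds`): for every `a ≠ 0` and EVERY level `0 < ε < 1/2` the band of
  `ζ − a` is infinite (`bandSet_zeta_sub_const_infinite`; `> KT` points in
  `1/2 + ε < σ < 3/4 + ε/2`). A proof must separate the value `0` from all other values — use
  `log ζ` / the Euler product ("resonances = zeros"), not value-distribution / growth / mean values
  in `1/2 < σ < 1`, which treat all values alike (barrier `BohrDenseValues` bites on every `a ≠ 0`).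
* DIFFERENTIATION DESTROYS THE BAND (§7c, unconditional: Voronin's disc universality PROVED in
  tree as `Steuding2007_thm1_9_discAnalytic_holds` + Cauchy's estimate + the tree's Rouché lemma
  `exists_zero_of_norm_sub_lt_norm`): `ζ'` has zeros above every height in every strip
  `1/2 < α < σ < β < 1` (`exists_deriv_zeta_zero_gt`), so EVERY band of `ζ'` of level `< 1/2` is
  infinite (`bandSet_deriv_zeta_infinite`, `not_asymptoticBand_deriv_zeta`) — through its RIGHT
  half, while its left half is of RH strength (Speiser 1934: RH ⟺ `ζ' ≠ 0` in `0 < σ < 1/2`;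
  Levinson–Montgomery 1974). The band is not inherited by derivatives / linear-differential
  expressions in `ζ`, and the symmetry `ρ ↦ 1 − ρ̄` behind "one-sided suffices"
  (`acl_iff_rightBand`) is precisely what `ζ'` lacks.
* TIGHTNESS OF THE LINE (§8, Hardy): the crux centred at any `σ₀ ≠ 1/2` is false
  (`not_band_at_other_line`): `1/2` is IN the accumulation set of `{Re ρ}`; the crux says the
  accumulation set is `{1/2}`.
* PROFILE OF ANY PROOF (cycles 1–2 combined): sensitive to temperedness of every local factor
  (5a) and to the exact half-density normalisation globally (7a: any width slack reproduces only
  the crux); non-additive (5b, 5d) and destroyed by additive shifts (5e); beyond Landau–Beurling (5c); value-`0`-specific (7b); not a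
  height-summability statement (6d); not inherited by `ζ'` (7c). I.e. an argument using the Euler product AND the functional
  equation of `ζ` EXACTLY — consistent with BarrierNotes-r1-k1 B4 (asymptotic adversary `ζ_adv`:
  exact FE, Euler product up to a bounded analytic error, violates the crux) and with the route's
  kill criteria (i)/(ii). Nothing cheaper is visible from the negative side; no kill exists short
  of `¬RH` (`not_riemannHypothesis_of_not_acl`).

## Cycle 3 findings (§§9–11; all `sorry`-free, axioms `propext / Classical.choice / Quot.sound`)

* KILL PROPAGATION DOWNWARDS (§9, Negative/`Lindelof`): the crux makes every window count
  `N(σ, T+1) − N(σ, T)`, `σ > 1/2`, vanish eventually (`windowCount_eventually_zero_of_acl`), so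
  BACKLUND's zero condition holds (`backlundZeroCondition_of_acl`, PROVED), hence LINDELÖF —
  UNCONDITIONALLY, Titchmarsh's Thms 13.5/13.2 being PROVED in tree (`lindelof_of_acl'`,
  `criticalMoment_isBigO_of_acl'`, Negative/`LindelofHolds`; the unprimed versions take the named
  facts as hypotheses) — and the DENSITY HYPOTHESIS outright
  (`densityHypothesis_of_acl`, PROVED: bounded counts for `σ > 1/2` + the tree's Ingham theorem at
  `σ = 1/2`). Sandwich `RH ⟹ #5 ⟹ crux ⟹ LH ∧ DH` (`acl_sandwich'`); kill propagation
  `not_acl_of_not_lindelof'`: `¬LH` (an `Ω(t^c)` result on the line) or `¬DH` would refute the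
  crux — neither is in sight (`μ(1/2) ≤ 13/84`; DH proved for `σ ≥ 25/32`).
* A SECOND TEMPERED BAND (§10, Negative/`Scaling`): `ζ(2s)` (unitary degree-2 Euler product, exact
  FE with centre `1/4`) has the populated line `Re s = 1/4`; `Z₂ = ζ(s)ζ(2s)` — multiplicative
  Ramanujan-bounded coefficients, abscissa `1`, simple pole at `1`, degree-3 Euler product over all
  primes with every local root on the unit circle (`localFactor_zetaZetaTwo`,
  `zetaZetaTwo_eulerProduct`) — has TWO populated lines `{1/2, 1/4}` (`not_asymptoticBand_zetaZetaTwo`,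
  Hardy): the kill shape realised by a tempered Euler product. Its right half-bands are `ζ`'s, so
  `Z₂` has the one-sided shape iff the crux holds and never the two-sided one
  (`rightBand_zetaZetaTwo_iff_acl`): the reflection `s ↦ 1 − s` behind `acl_iff_rightBand` is
  load-bearing; so are holomorphy at `1/2` and, in the dictionary, the EXACT weights of the
  iterates of periodic orbits (`Λ₂(p^{2j}) = 3 log p` gives a band at half depth).
* THE TWO HALVES OF THE CRUX (§11, Negative/`Split`; pre-emptive targets for the surviving card
  interior-edge-split): `NoInteriorBandShape` / `EdgeZeroFreeShape` typed for general `Z` (the card's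
  statements verbatim at `Z = ζ`; the edge half IS route Strip's crux 0349,
  `edgeZeroFree_zeta_iff`), crux ⟹ both (`halves_of_acl`), and the model zoo sorted by the half it
  breaks, all unconditional: interior-only — `zetaTwistedAtTwo` (line `3/4`), `Z₂` (line `1/4`),
  `shiftedZeta a` (lines `1/2 ± a`), with `edge_zetaTwistedAtTwo_iff` / `edge_zetaZetaTwo_iff`:
  their edge half is exactly `ζ`'s; both halves — `swF` (so DH, Hurwitz: `≫ T` zeros in EVERY strip
  `1/2 ≤ σ₁ < σ < σ₂ ≤ 1`, `swF_zeros_infinite`), `ζ − a`, `ζ'`; Beurling's world kills BOTH halves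
  too: the edge by DMV 2006 (§5c, prose) and — NEW FROM PRINT, §11c — the INTERIOR by Broucke 2024
  Thm 6.3 (arXiv:2409.10051, READ pp. 14–15): `θ`-well-behaved Beurling integers, `θ ≥ 1/2`
  (`O(√x log x)` at `θ = 1/2`), whose zeta has `ζ`'s zeros rescaled onto the interior line
  `(1+θ)/2`; typed at `θ = 1/2` as `zetaRescaledHalf = ζ(2s−1)` with counting function
  `N(x) = ∑_{n² ≤ x} n`, `|N(x) − x/2| ≤ √x` (`abs_rescaledCount_sub_le`), populated line `3/4`
  (`not_noInterior_zetaRescaledHalf`, `edge_zetaRescaledHalf_iff`). This answers the card's (F2):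
  NoInteriorBand is NOT Beurling-soft; any proof of it from multiplicativity + `N(x) = Ax + O(x^θ)`
  needs `θ < 1/2`.
  So the interior half alone needs every local-exactness input identified for the crux; only the
  integrality/Beurling input is edge-specific; conditionally on Strip's crux, `zetaTwistedAtTwo`
  and `Z₂` are explicit "edge true, interior false" objects — and UNCONDITIONALLY so is the
  TRUNCATION `ζ₃(s) = 1 + 2^{−s} + 3^{−s}` (§11b): infinitely many zeros in every window around the
  root `σ₃ ∈ (1/2,1)` of `2^{−σ} + 3^{−σ} = 1` (Bohr equivalence with the Liouville twist +
  Kronecker + Hurwitz, the tree's `TuranPartialSums` toolkit) and none to the right of `σ₃`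
  (`zetaPartialSum_three_interior_band`, `edge_zetaPartialSum_three`,
  `not_noInterior_zetaPartialSum_three`): the halves are independent, and the band shape belongs
  to the complete series / infinite product, never to a truncation (approximate functional
  equation pieces, Dirichlet-polynomial models).

* TWO MORE FORMS (§12, Negative/`FormsMore`): Faure–Tsujii's LITERAL shape (first band + deep
  region `Re z < −χ₀ + τ`), transported with no strip restriction, ⟺ crux for every `χ₀ ≥ 0`
  (`ftShape_iff_acl`: left of the strip only trivial zeros) — the transport is faithful, and `ζ`
  has NO populated lower band (disanalogy with the Weyl law of every Anosov band); LIMIT form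
  `acl_iff_tendsto`: `|Re ρ − 1/2| → 0` along the cofinite filter of non-trivial zeros.

## Cycle 4 findings (§§14–16; all `sorry`-free, axioms `propext / Classical.choice / Quot.sound`)

* PERIODIC MODELS COLLAPSE THE LADDER (§14, Negative/`Periodic`, p81379 ACCEPTED): if the strip zero set is
  invariant under `s ↦ s + iτ`, `τ ≠ 0`, one off-line zero generates an infinite band at its own
  level (`bandSet_infinite_of_mem_offLineSet`), so `AsymptoticBand Z ⟺ offLineSet Z = ∅ ⟺
  (offLineSet Z).Finite` (`asymptoticBand_iff_offLineSet_eq_empty`, `offLineSet_finite_iff_eq_empty`):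
  rung #4 ⟺ rung #5 ⟺ exact. Instances: every `Z(s) = P(q^{−s})` (`asymptoticBand_comp_cpow_iff`;
  zeta functions over `𝔽_q` — a function-field sanity rung tests Weil's theorem, not band
  strength); one Euler factor `1 − α p^{−s}`, whose zeros fill the line `Re s = log ‖α‖ / log p`
  (`re_eq_of_eulerTerm_eq_zero`; shape FALSE iff `1 < ‖α‖ < p`, `‖α‖ ≠ √p`:
  `not_asymptoticBand_eulerTerm`, generalising §5a; TRUE with all zeros critical for `‖α‖ = √p`;
  vacuous for `‖α‖ ≤ 1`); FINITE Euler products `∏ᵢ (1 − αᵢ pᵢ^{−s})`: shape ⟺ no factor has an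
  off-line zero (`asymptoticBand_finiteEuler_iff`), and the local factors of `ζ` give EMPTY bands
  for every finite set of primes (`bandSet_zetaLocalFactors_eq_empty`). Reading: the slack of #4
  below RH (§6d) needs an aperiodic zero set — the infinite product / the archimedean place
  (`|χ(σ+it)| ≍ t^{1/2−σ}` is the only height scale); it is invisible in the `S`-local layer of the
  route's TWO-LAYER PLAN (empty zero content — all content is the uniformity as `S → ∞`) and over
  function fields.
* ALMOST ALL IS A THEOREM (§15, Negative/`AlmostAll`, p81473 ACCEPTED): `bandProportion ε T = N(1/2+ε, T)/N(T)
  = O(T^{−2ε/(3−2ε)}) → 0` (`bandProportion_isBigO_rpow_neg`, `tendsto_bandProportion_zero`; Ingham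
  `zeroDensity_ingham_holds` + `riemann_von_mangoldt_holds`, both PROVED): for every `ε > 0`
  asymptotically 100% of the zeros lie within `ε` of the line — indeed within
  `A log log T / log T` (`tendsto_shrinkingBandProportion_zero`, from the tree's PROVED uniform
  Selberg density theorem `selberg_zeroDensity_near_half`, proportion `≤ C/log T`). The crux is the
  everywhere version (count `O(1)`, `countRe_bounded_of_acl`) of this almost-everywhere theorem;
  nothing in between is known for `ζ`.
* THE ENGINE IS SHARP AT RUNG #4 (§16, Negative/`EngineSharp`, p81557 ACCEPTED): the diagonal group
  `T t = diag(e^{t zₙ})` on `ℓ²(ℕ, ℂ)` (`diagGroup`; `diagGroup_zero`, `diagGroup_add`,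
  `diagGroup_basis`) is unitary + compact AT EVERY TIME as soon as `Re zₙ → 0`
  (`isCompactOperator_diagGroup_sub_phase`, `phaseOp_mem_unitary`); with `zₙ = 1/(n+2) + in` the
  hypotheses of `BandEngine` hold while ALL joint eigenvalues are off the line, infinitely many,
  accumulating at it (`exists_engineModel_infinite_offLine`). So "unitary modulo compact" can never
  give rung #5 or X (reality/self-adjointness is a separate input, as for DFG), and the same
  `diagGroup` over `ρₙ − 1/2` is the witness the support `AsymptoticToRealisation` needs.
* LITERATURE REFRESH (cycle 4; SEARCH DEGRADED: local searchd reset, arXiv / OpenAlex / S2 HTTP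
  429, zbMATH 1 unusable hit; Crossref 2024–26 returns only unrefereed "RH (dis)proved" preprints,
  e.g. doi:10.2139/ssrn.4762661, none exhibiting a verifiable off-line zero): no refereed claim of a
  second band / infinitely many off-line zeros of `ζ`; conditional kills unchanged (`¬LH ⟹ ¬crux`,
  `¬DH ⟹ ¬crux`; best density exponent Guth–Maynard 2024 `N(σ,T) ≪ T^{30(1−σ)/13+o(1)}`, tree
  `zeroDensity_guth_maynard`). POSITIVE TOY in print where the cofinite shape IS a theorem for a
  `ζ`-like object: Gonek's (non-analytic) finite-Euler-product models
  `ζ_X(s) = P_X(s) + χ(s)·conj(P_X(s))` (arXiv:0704.3448 = Trans. AMS 364 (2012), Thm 6.2 READ: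
  every zero with `0 ≤ β ≤ 1`, `γ ≥ C₀` has `β = 1/2`, because `P_X` never vanishes and
  `|χ(σ+it)| = 1` forces `σ = 1/2` for large `t`, `log|χ(σ₁+it)| = (1/2−σ₁) log(t/2π) + O(·)`):
  the line comes from FE-exactness plus a zero-free local part — the two exactness inputs
  profiled in §§5a, 7a, 10, 11b — and the height scale `|χ| ≍ t^{1/2−σ}` is exactly the
  aperiodicity that §14 shows to be indispensable.

## Targets
LINE PICKED during cycle 3 (PICKED.md, lead prover-line-stmt-RiemannHypothesis-2063-0):
`interior-edge-split`, stubs `stub_noRightInteriorBand` (hardest) and `stub_edgeZeroFreeStrip`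
(= route Strip's crux stmt-10660). §13 restates both VERBATIM and records: BOTH ARE UNKILLABLE short
of `¬RH` (`stubs_of_riemannHypothesis`; 2 targets, 0 broken, no `stub-false` possible); forms of
stub 1 (⟺ two-sided interior shape; strip clauses redundant; one finite window = an eventual
zero-free vertical neighbourhood of `σ₀`, open at every `σ₀` — no partial credit); and its profile
in its own right-sided shape (fails for every relaxed object of the zoo on the right of the line,
incl. truncation `ζ₃` with stub 2's shape TRUE, and Beurling `θ = 1/2`; equals stub 1 for
`Z₂ = ζ(s)ζ(2s)`, whose second band at `1/4` a right-sided statement cannot see). Pre-emptive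
two-sided analysis: §11.

## Near-misses
No unconditional near-miss exists: a witness against the crux is an accumulating family of
off-line zeros of `ζ` (`not_acl_iff`), which no method or computation produces (RH verified to
height `3·10¹²`). CONDITIONAL KILLS recorded as theorems: `not_acl_of_not_lindelof`
(`Titchmarsh1986_thm13_5 → ¬LindelofHypothesis → ¬crux`) and, unconditionally in the hypothesis,
`¬DensityHypothesis → ¬crux` (contrapositive of `densityHypothesis_of_acl`). Printed scepticism
about RH — Ivić 2003, "On some reasons for doubting the Riemann hypothesis" (arXiv:math/0311162;
abstract and §1 READ: Lehmer's phenomenon, the Davenport–Heilbronn zeta-function, large and mean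
values of `|ζ(1/2+it)|`, zeros of convolution functions `M_{Z,f}(t)`, and a CONDITIONAL disproof
of RH by contradiction in its §9) — offers no mechanism producing a SECOND BAND: none of these
arguments says where hypothetical off-line zeros would lie, so none bears on the crux beyond
`¬RH`; Farmer 2022 (arXiv:2211.11671, "Currently there are no reasons to doubt the Riemann
Hypothesis") rebuts them. The Davenport–Heilbronn analogy is exactly §5d here (additivity), not
evidence about `ζ`.
-/

noncomputable section

set_option linter.dupNamespace false

namespace Summit.RiemannHypothesis.RiemannHypothesis.Cruxes.AsymptoticCriticalLine.Disproof

open Complex Set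
open Summit.RiemannHypothesis.RiemannHypothesis.Theses.RuelleBand
open Summit.RiemannHypothesis.RiemannHypothesis.Theorems.AsymptoticCriticalLine.Negative (bandSet)

/-! ## A. Cycles 1–3 (§§0–13): LANDED — aliases of the headline theorems under their historical names

The Lean text is in the imported `Negative/` modules (see LAYOUT and NAME MAP in the header). The
aliases below are definitional (`AsymptoticBand Z` unfolds to the landed written-out shape) and keep
the historical names of this index resolvable in this namespace. -/

section aliases

open Summit.RiemannHypothesis.RiemannHypothesis.Theorems.AsymptoticCriticalLine.Negative
  (acl_iff_bandSet not_acl_iff acl_iff_rightBand acl_iff_height acl_iff_nontrivial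
  bandSet_eq_empty_of_riemannHypothesis eventually_zeroFree_of_bandSet_finite
  zetaTwistedAtTwo not_band_zetaTwistedAtTwo swF not_band_swF exists_beurling_not_band
  not_band_davenportHeilbronn hurwitzFifth not_band_hurwitzFifth
  not_band_shiftedZeta not_band_zeta_sub_const not_band_deriv_zeta
  not_forall_powerSum_imp_finite not_forall_heightSum_imp_band not_band_at_other_line
  not_riemannHypothesis_of_not_acl band_mul_iff band_congr acl_iff_completedRiemannZeta
  backlundZeroCondition_of_acl densityHypothesis_of_acl acl_sandwich zetaTwoMul not_band_zetaTwoMul zetaZetaTwo not_band_zetaZetaTwo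
  rightBand_zetaZetaTwo_iff_acl NoInteriorBandShape EdgeZeroFreeShape halves_of_acl
  not_band_zetaPartialSum_three
  zetaRescaledHalf not_band_zetaRescaledHalf ftShape_iff_acl acl_iff_tendsto)

/-- The abstract shape of the crux for an arbitrary `Z : ℂ → ℂ` ("`Θ_ess(Z) = 1/2`": every band set
of positive level is finite); unfolds to the written-out shape of the landed files. [folklore] -/
abbrev AsymptoticBand (Z : ℂ → ℂ) : Prop :=
  ∀ ε : ℝ, 0 < ε → (bandSet Z ε).Finite

/-- The crux is literally the band shape of `riemannZeta` (landed: `acl_iff_bandSet`). [folklore] -/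
theorem acl_iff_asymptoticBand : AsymptoticCriticalLine ↔ AsymptoticBand riemannZeta := Iff.rfl

/-- §4 (landed `bandSet_eq_empty_of_riemannHypothesis`): RH ⟹ crux — no kill short of `¬RH`. [folklore] -/
theorem asymptoticBand_zeta_of_riemannHypothesis (hRH : RiemannHypothesis) :
    AsymptoticBand riemannZeta := fun ε hε => by
  rw [bandSet_eq_empty_of_riemannHypothesis hRH hε]
  exact Set.finite_empty

/-- §5a (landed `not_band_zetaTwistedAtTwo`): one non-tempered factor, a full band at `3/4`. [folklore] -/
theorem not_asymptoticBand_zetaTwistedAtTwo : ¬ AsymptoticBand zetaTwistedAtTwo :=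
  not_band_zetaTwistedAtTwo

/-- §5b (landed `not_band_swF`): `L(s,χ₃) + L(s,χ₅)` — non-additivity (Saias–Weingartner). [folklore] -/
theorem not_asymptoticBand_swF : ¬ AsymptoticBand swF := not_band_swF

/-- §5d (landed `not_band_davenportHeilbronn`). [folklore] -/
theorem not_asymptoticBand_davenportHeilbronn :
    ¬ AsymptoticBand Literature.Barriers.RiemannHypothesis.davenportHeilbronn :=
  not_band_davenportHeilbronn

/-- §5e (landed `not_band_hurwitzFifth`): the Hurwitz shift `ζ(s, 1/5)`. [folklore] -/
theorem not_asymptoticBand_hurwitzFifth : ¬ AsymptoticBand hurwitzFifth := not_band_hurwitzFifth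

/-- §7c (landed `not_band_deriv_zeta`): differentiation destroys the band. [folklore] -/
theorem not_asymptoticBand_deriv_zeta : ¬ AsymptoticBand (deriv riemannZeta) := not_band_deriv_zeta

/-- §10 (landed `not_band_zetaZetaTwo`): the tempered degree-3 product `ζ(s)ζ(2s)`, bands `{1/2, 1/4}`. [folklore] -/
theorem not_asymptoticBand_zetaZetaTwo : ¬ AsymptoticBand zetaZetaTwo := not_band_zetaZetaTwo

/-- §11b (landed `not_band_zetaPartialSum_three`): the truncation `1 + 2^{−s} + 3^{−s}`. [folklore] -/
theorem not_asymptoticBand_zetaPartialSum_three :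
    ¬ AsymptoticBand (Literature.Barriers.RiemannHypothesis.zetaPartialSum 3) :=
  not_band_zetaPartialSum_three

/-- §11c (landed `not_band_zetaRescaledHalf`): Beurling `θ = 1/2`, `ζ(2s − 1)`. [folklore] -/
theorem not_asymptoticBand_zetaRescaledHalf : ¬ AsymptoticBand zetaRescaledHalf :=
  not_band_zetaRescaledHalf

/-- §§4, 6c, 9 (landed `acl_sandwich`, `densityHypothesis_of_acl`, `not_riemannHypothesis_of_not_acl`;
the unconditional Lindelöf corollary `acl_sandwich'` is in `Negative/LindelofHolds`): the crux sits
in `RH ⟹ #5 ⟹ crux ⟹ LH ∧ DH`, and a kill of the crux is a disproof of RH. [folklore] -/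
theorem calibration_summary :
    (RiemannHypothesis → AsymptoticCriticalLine) ∧
      (AsymptoticCriticalLine → Literature.NumberTheory.LFunctions.DensityHypothesis) ∧
      (AsymptoticCriticalLine → Literature.NumberTheory.LFunctions.LindelofHypothesis) ∧
      (¬ AsymptoticCriticalLine → ¬ RiemannHypothesis) :=
  ⟨acl_sandwich.1, acl_sandwich.2.1,
    acl_sandwich.2.2 Literature.Barriers.RiemannHypothesis.Titchmarsh1986_thm13_5_holds,
    not_riemannHypothesis_of_not_acl⟩

end aliases

/-! ## 14. Vertically periodic models: the ladder collapses (cycle 4; LANDED as Negative/`Periodic`, p81379)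

If the strip zero set of `Z` is invariant under a vertical translation `s ↦ s + iτ`, `τ ≠ 0` —
every function of `q^{-s}` (zeta functions `Z(X, q^{-s})` over `𝔽_q`, Dirichlet polynomials in
one prime), a single Euler factor `1 − α p^{−s}`, and factor by factor every FINITE Euler
product — then ONE off-line zero generates a whole band at its own level: rung #4 ⟺ rung #5 ⟺
"no off-line zero at all". The slack of the crux below RH (infinitely many off-line zeros with
`Re ρ → 1/2` allowed, §6d) needs an APERIODIC zero set, i.e. the infinite product with its
archimedean height dependence (`|χ(σ+it)| ≍ t^{1/2−σ}` is the only "semiclassical parameter"):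
it is invisible prime by prime (the `S`-local layer of the route's TWO-LAYER PLAN has EMPTY zero
content: `bandSet_zetaLocalFactors_eq_empty`, and the `S`-local zeta `π^{−s/2} Γ(s/2) ∏_{p∈S}(1−p^{−s})⁻¹`
is zero-free on `Re s > 0`, `bandSet_localZeta_eq_empty` — everything sits in the uniformity as
`S → ∞`) and over function fields (the route's missing "function-field sanity rung" would test Weil's full
RH-shape, never band-strength versus RH-strength). -/

section periodic

open Summit.RiemannHypothesis.RiemannHypothesis.Theorems.AsymptoticCriticalLine.Negative
  (offLineSet bandSet_subset_offLineSet band_mul_iff bandSet_mul)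
open Literature.NumberTheory.LFunctions (eulerTerm eulerTerm_eq_zero_iff eulerTermZero
  eulerTerm_eulerTermZero norm_eq_rpow_of_eulerTerm_eq_zero natCast_cpow_neg_eq_exp
  ne_zero_of_eulerTerm_eq_zero)



/-! ## Vertical periodicity of a zero set -/

/-- The zero set of `Z` is invariant under the vertical translation `s ↦ s + iτ`. [folklore] -/
def VertPeriodic (Z : ℂ → ℂ) (τ : ℝ) : Prop :=
  ∀ s : ℂ, Z s = 0 → Z (s + τ * I) = 0

/-- Iterating the period. [folklore] -/
theorem VertPeriodic.iterate {Z : ℂ → ℂ} {τ : ℝ} (h : VertPeriodic Z τ) {s : ℂ} (hs : Z s = 0)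
    (n : ℕ) : Z (s + n * τ * I) = 0 := by
  induction n with
  | zero => simpa using hs
  | succ n ih =>
    have := h _ ih
    convert this using 2
    push_cast
    ring

/-- The translates `s + inτ`, `n ∈ ℕ`. [folklore] -/
def vertTranslate (s : ℂ) (τ : ℝ) (n : ℕ) : ℂ :=
  s + n * τ * I

/-- [folklore] -/
theorem vertTranslate_re (s : ℂ) (τ : ℝ) (n : ℕ) : (vertTranslate s τ n).re = s.re := by
  simp [vertTranslate]

/-- [folklore] -/
theorem vertTranslate_im (s : ℂ) (τ : ℝ) (n : ℕ) : (vertTranslate s τ n).im = s.im + n * τ := by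
  simp [vertTranslate]

/-- [folklore] -/
theorem vertTranslate_injective (s : ℂ) {τ : ℝ} (hτ : τ ≠ 0) :
    Function.Injective (vertTranslate s τ) := by
  intro a b hab
  have h := congrArg Complex.im hab
  rw [vertTranslate_im, vertTranslate_im, add_right_inj] at h
  exact_mod_cast mul_right_cancel₀ hτ h

/-- ONE OFF-LINE ZERO GENERATES A BAND: under vertical periodicity every off-line zero `s` of the
open strip puts the infinite set `{s + inτ}` into the band of level `|Re s − 1/2|`. [folklore] -/
theorem bandSet_infinite_of_mem_offLineSet {Z : ℂ → ℂ} {τ : ℝ} (hτ : τ ≠ 0) (h : VertPeriodic Z τ)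
    {s : ℂ} (hs : s ∈ offLineSet Z) : (bandSet Z |s.re - 1 / 2|).Infinite := by
  obtain ⟨hz, h0, h1, _⟩ := hs
  have hsub : Set.range (vertTranslate s τ) ⊆ bandSet Z |s.re - 1 / 2| := by
    rintro _ ⟨n, rfl⟩
    refine ⟨h.iterate hz n, ?_, ?_, ?_⟩
    · rw [vertTranslate_re]; exact h0
    · rw [vertTranslate_re]; exact h1
    · rw [vertTranslate_re]
  exact (Set.infinite_range_of_injective (vertTranslate_injective s hτ)).mono hsub

/-- LADDER COLLAPSE, rung #4: for a vertically periodic zero set the band shape (every band of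
positive level finite) holds iff there is NO off-line zero in the open strip. [folklore] -/
theorem band_iff_offLineSet_eq_empty {Z : ℂ → ℂ} {τ : ℝ} (hτ : τ ≠ 0) (h : VertPeriodic Z τ) :
    (∀ ε : ℝ, 0 < ε → (bandSet Z ε).Finite) ↔ offLineSet Z = ∅ := by
  constructor
  · intro hb
    by_contra hne
    obtain ⟨s, hs⟩ := Set.nonempty_iff_ne_empty.2 hne
    have hε : 0 < |s.re - 1 / 2| := abs_pos.2 (sub_ne_zero.2 hs.2.2.2)
    exact bandSet_infinite_of_mem_offLineSet hτ h hs (hb _ hε)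
  · intro he ε hε
    have : bandSet Z ε = ∅ := Set.eq_empty_of_subset_empty (he ▸ bandSet_subset_offLineSet Z hε)
    rw [this]
    exact Set.finite_empty

/-- LADDER COLLAPSE, rung #5: for a vertically periodic zero set the off-line zero set is finite
iff it is empty. So #4 ⟺ #5 ⟺ "exact" on periodic models. [folklore] -/
theorem offLineSet_finite_iff_eq_empty {Z : ℂ → ℂ} {τ : ℝ} (hτ : τ ≠ 0) (h : VertPeriodic Z τ) :
    (offLineSet Z).Finite ↔ offLineSet Z = ∅ := by
  refine ⟨fun hf => ?_, fun he => he ▸ Set.finite_empty⟩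
  by_contra hne
  obtain ⟨s, hs⟩ := Set.nonempty_iff_ne_empty.2 hne
  have hε : 0 < |s.re - 1 / 2| := abs_pos.2 (sub_ne_zero.2 hs.2.2.2)
  exact bandSet_infinite_of_mem_offLineSet hτ h hs (hf.subset (bandSet_subset_offLineSet Z hε))

/-- On periodic models the two rungs coincide. [folklore] -/
theorem band_iff_offLineSet_finite {Z : ℂ → ℂ} {τ : ℝ} (hτ : τ ≠ 0) (h : VertPeriodic Z τ) :
    (∀ ε : ℝ, 0 < ε → (bandSet Z ε).Finite) ↔ (offLineSet Z).Finite := by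
  rw [band_iff_offLineSet_eq_empty hτ h, offLineSet_finite_iff_eq_empty hτ h]

/-! ## Functions of `q^{-s}` (the function-field shape) -/

/-- `q^{-iτ} = 1` for the period `τ = 2π / log q` (`q > 1` a natural number). [folklore] -/
theorem natCast_cpow_neg_period {q : ℕ} (hq : 1 < q) :
    (q : ℂ) ^ (-(((2 * Real.pi / Real.log q : ℝ) : ℂ) * I)) = 1 := by
  have hq0 : (q : ℂ) ≠ 0 := by exact_mod_cast (by omega : q ≠ 0)
  have hlog : Real.log q ≠ 0 :=
    Real.log_ne_zero_of_pos_of_ne_one (by exact_mod_cast (by omega : 0 < q)) (by exact_mod_cast hq.ne')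
  have h1' : Real.log q * (2 * Real.pi / Real.log q) = 2 * Real.pi := by field_simp
  have h1 : (Real.log q : ℂ) * ((2 * Real.pi / Real.log q : ℝ) : ℂ) = 2 * Real.pi := by
    rw [← ofReal_mul, h1']; push_cast; ring
  rw [cpow_def_of_ne_zero hq0, ← Complex.natCast_log]
  have : (Real.log q : ℂ) * -(((2 * Real.pi / Real.log q : ℝ) : ℂ) * I) = (-1 : ℤ) * (2 * Real.pi * I) := by
    calc (Real.log q : ℂ) * -(((2 * Real.pi / Real.log q : ℝ) : ℂ) * I)
        = -((Real.log q : ℂ) * ((2 * Real.pi / Real.log q : ℝ) : ℂ)) * I := by ring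
      _ = (-1 : ℤ) * (2 * Real.pi * I) := by rw [h1]; push_cast; ring
  rw [this, exp_int_mul_two_pi_mul_I]

/-- `q^{-(s + iτ)} = q^{-s}` for the period `τ = 2π / log q`. [folklore] -/
theorem natCast_cpow_neg_add_period {q : ℕ} (hq : 1 < q) (s : ℂ) :
    (q : ℂ) ^ (-(s + (2 * Real.pi / Real.log q : ℝ) * I)) = (q : ℂ) ^ (-s) := by
  have hq0 : (q : ℂ) ≠ 0 := by exact_mod_cast (by omega : q ≠ 0)
  rw [neg_add, cpow_add _ _ hq0, natCast_cpow_neg_period hq, mul_one]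

/-- Every function of `q^{-s}` — e.g. the zeta function `Z(X, q^{-s})` of a variety over `𝔽_q`,
or a Dirichlet polynomial in the powers of one prime — has a vertically periodic zero set, with
period `2π / log q`. [folklore] -/
theorem vertPeriodic_comp_cpow (P : ℂ → ℂ) {q : ℕ} (hq : 1 < q) :
    VertPeriodic (fun s => P ((q : ℂ) ^ (-s))) (2 * Real.pi / Real.log q) := by
  intro s hs
  simpa only [natCast_cpow_neg_add_period hq] using hs

/-- [folklore] -/
theorem period_ne_zero {q : ℕ} (hq : 1 < q) : 2 * Real.pi / Real.log q ≠ 0 := by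
  have : 0 < Real.log q := Real.log_pos (by exact_mod_cast hq)
  positivity

/-- FUNCTION-FIELD SHAPE: for `Z(s) = P(q^{-s})` rung #4 holds iff there is no off-line zero in the
open strip — over `𝔽_q` the band shape is the full RH-shape (Weil's theorem for curves), and a
"function-field sanity rung" cannot separate rung #4 from thesis X. [folklore] -/
theorem band_comp_cpow_iff (P : ℂ → ℂ) {q : ℕ} (hq : 1 < q) :
    (∀ ε : ℝ, 0 < ε → (bandSet (fun s => P ((q : ℂ) ^ (-s))) ε).Finite) ↔
      offLineSet (fun s => P ((q : ℂ) ^ (-s))) = ∅ :=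
  band_iff_offLineSet_eq_empty (period_ne_zero hq) (vertPeriodic_comp_cpow P hq)

/-! ## A single Euler factor `1 − α p^{−s}` -/

/-- An Euler factor is a function of `p^{-s}`, hence vertically periodic. [folklore] -/
theorem vertPeriodic_eulerTerm {p : ℕ} (hp : 1 < p) (α : ℂ) :
    VertPeriodic (eulerTerm p α) (2 * Real.pi / Real.log p) :=
  vertPeriodic_comp_cpow (fun x => 1 - α * x) hp

/-- The zeros of `1 − α p^{−s}` fill ONE vertical line, `Re s = log ‖α‖ / log p`. [folklore] -/
theorem re_eq_of_eulerTerm_eq_zero {p : ℕ} (hp : 1 < p) {α s : ℂ} (h : eulerTerm p α s = 0) :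
    s.re = Real.log ‖α‖ / Real.log p := by
  have hp0 : 0 < p := by omega
  have hlog : 0 < Real.log p := Real.log_pos (by exact_mod_cast hp)
  have hn := norm_eq_rpow_of_eulerTerm_eq_zero hp0 h
  rw [hn, Real.log_rpow (by exact_mod_cast hp0), mul_div_assoc, div_self hlog.ne', mul_one]

/-- Rung #4 for one Euler factor ⟺ no zero of the factor is off-line in the open strip. [folklore] -/
theorem band_eulerTerm_iff {p : ℕ} (hp : 1 < p) (α : ℂ) :
    (∀ ε : ℝ, 0 < ε → (bandSet (eulerTerm p α) ε).Finite) ↔ offLineSet (eulerTerm p α) = ∅ :=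
  band_iff_offLineSet_eq_empty (period_ne_zero hp) (vertPeriodic_eulerTerm hp α)

/-- If the line `Re s = log ‖α‖ / log p` lies in the open strip and off the critical line
(`1 < ‖α‖ < p`, `‖α‖ ≠ √p`), the factor `1 − α p^{−s}` carries a whole infinite band: the shape
FAILS (this generalises the non-tempered twist `1 − 2^{3/4−s}` of `not_band_zetaTwistedAtTwo`).
[folklore] -/
theorem not_band_eulerTerm {p : ℕ} (hp : 1 < p) {α : ℂ} (h1 : 1 < ‖α‖) (h2 : ‖α‖ < p)
    (h3 : ‖α‖ ≠ Real.sqrt p) : ¬ ∀ ε : ℝ, 0 < ε → (bandSet (eulerTerm p α) ε).Finite := by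
  rw [band_eulerTerm_iff hp]
  have hα : α ≠ 0 := fun h => by rw [h, norm_zero] at h1; linarith
  have hp0 : 0 < p := by omega
  have hp1 : (1 : ℝ) < p := by exact_mod_cast hp
  set s := eulerTermZero p α 0 with hs_def
  have hz : eulerTerm p α s = 0 := eulerTerm_eulerTermZero hp hα 0
  have hn : ‖α‖ = (p : ℝ) ^ s.re := norm_eq_rpow_of_eulerTerm_eq_zero hp0 hz
  have h0 : 0 < s.re := by
    by_contra hle
    have : (p : ℝ) ^ s.re ≤ (p : ℝ) ^ (0 : ℝ) := Real.rpow_le_rpow_of_exponent_le hp1.le (not_lt.1 hle)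
    rw [Real.rpow_zero, ← hn] at this
    linarith
  have h1' : s.re < 1 := by
    by_contra hle
    have : (p : ℝ) ^ (1 : ℝ) ≤ (p : ℝ) ^ s.re := Real.rpow_le_rpow_of_exponent_le hp1.le (not_lt.1 hle)
    rw [Real.rpow_one, ← hn] at this
    linarith
  have hhalf : s.re ≠ 1 / 2 := by
    intro h
    rw [h, ← Real.sqrt_eq_rpow] at hn
    exact h3 hn
  intro he
  have : s ∈ offLineSet (eulerTerm p α) := ⟨hz, h0, h1', hhalf⟩
  rw [he] at this
  exact this

/-- If `‖α‖ = √p` every zero of `1 − α p^{−s}` lies ON the critical line: the shape holds (with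
infinitely many critical zeros). [folklore] -/
theorem band_eulerTerm_of_norm_eq_sqrt {p : ℕ} (hp : 1 < p) {α : ℂ} (h : ‖α‖ = Real.sqrt p) :
    ∀ ε : ℝ, 0 < ε → (bandSet (eulerTerm p α) ε).Finite := by
  rw [band_eulerTerm_iff hp]
  ext s
  simp only [offLineSet, mem_setOf_eq, mem_empty_iff_false, iff_false, not_and, not_not]
  intro hz _ _
  have hp0 : 0 < p := by omega
  have hp1 : (1 : ℝ) < p := by exact_mod_cast hp
  have hn : ‖α‖ = (p : ℝ) ^ s.re := norm_eq_rpow_of_eulerTerm_eq_zero hp0 hz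
  rw [h, Real.sqrt_eq_rpow] at hn
  exact le_antisymm ((Real.rpow_le_rpow_left_iff hp1).1 hn.ge) ((Real.rpow_le_rpow_left_iff hp1).1 hn.le)

/-- If `‖α‖ ≤ 1` (e.g. the local factors `1 − p^{−s}` of `ζ`, or any factor with a unitary
root) the factor has NO zero in the open strip: the shape holds vacuously. [folklore] -/
theorem bandSet_eulerTerm_eq_empty_of_norm_le_one {p : ℕ} (hp : 1 < p) {α : ℂ} (h : ‖α‖ ≤ 1)
    (ε : ℝ) : bandSet (eulerTerm p α) ε = ∅ := by
  ext s
  simp only [bandSet, mem_setOf_eq, mem_empty_iff_false, iff_false, not_and]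
  intro hz h0 _ _
  have hp0 : 0 < p := by omega
  have hp1 : (1 : ℝ) < p := by exact_mod_cast hp
  have hn : ‖α‖ = (p : ℝ) ^ s.re := norm_eq_rpow_of_eulerTerm_eq_zero hp0 hz
  have : (1 : ℝ) < (p : ℝ) ^ s.re := Real.one_lt_rpow hp1 h0
  linarith

/-! ## Finite Euler products -/

/-- The constant function `1` has empty bands. [folklore] -/
theorem bandSet_one (ε : ℝ) : bandSet (fun _ : ℂ => (1 : ℂ)) ε = ∅ := by
  ext s
  simp [bandSet]

/-- Off-line zeros of a product are the off-line zeros of the factors. [folklore] -/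
theorem offLineSet_mul (Z W : ℂ → ℂ) :
    offLineSet (fun s => Z s * W s) = offLineSet Z ∪ offLineSet W := by
  ext s
  simp only [offLineSet, mem_setOf_eq, mem_union, mul_eq_zero]
  tauto

/-- FINITE EULER PRODUCTS: `∏ᵢ (1 − αᵢ pᵢ^{−s})` has the band shape iff NO factor has an
off-line zero in the open strip — rung #4 ⟺ the exact RH-shape, factor by factor. The asymptotic
slack of rung #4 (off-line zeros with `Re ρ → 1/2`) needs the infinite product. [folklore] -/
theorem band_finiteEuler_iff {ι : Type*} (S : Finset ι) (p : ι → ℕ) (α : ι → ℂ)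
    (hp : ∀ i ∈ S, 1 < p i) :
    (∀ ε : ℝ, 0 < ε → (bandSet (fun s => ∏ i ∈ S, eulerTerm (p i) (α i) s) ε).Finite) ↔
      ∀ i ∈ S, offLineSet (eulerTerm (p i) (α i)) = ∅ := by
  classical
  induction S using Finset.induction_on with
  | empty =>
    simp only [Finset.prod_empty, Finset.notMem_empty, IsEmpty.forall_iff, implies_true, iff_true]
    intro ε _
    rw [bandSet_one]
    exact Set.finite_empty
  | insert a S ha ih =>
    have hfun : (fun s => ∏ i ∈ insert a S, eulerTerm (p i) (α i) s) =
        fun s => eulerTerm (p a) (α a) s * ∏ i ∈ S, eulerTerm (p i) (α i) s := by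
      funext s
      exact Finset.prod_insert ha
    rw [hfun, band_mul_iff, ih fun i hi => hp i (Finset.mem_insert_of_mem hi),
      band_eulerTerm_iff (hp a (Finset.mem_insert_self a S)), Finset.forall_mem_insert]

/-- … equivalently, iff the product itself has no off-line zero in the open strip. [folklore] -/
theorem band_finiteEuler_iff_offLineSet_eq_empty {ι : Type*} (S : Finset ι) (p : ι → ℕ)
    (α : ι → ℂ) (hp : ∀ i ∈ S, 1 < p i) :
    (∀ ε : ℝ, 0 < ε → (bandSet (fun s => ∏ i ∈ S, eulerTerm (p i) (α i) s) ε).Finite) ↔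
      offLineSet (fun s => ∏ i ∈ S, eulerTerm (p i) (α i) s) = ∅ := by
  classical
  rw [band_finiteEuler_iff S p α hp]
  have key : offLineSet (fun s => ∏ i ∈ S, eulerTerm (p i) (α i) s) =
      ⋃ i ∈ S, offLineSet (eulerTerm (p i) (α i)) := by
    ext s
    simp only [offLineSet, mem_setOf_eq, mem_iUnion, Finset.prod_eq_zero_iff, exists_prop]
    constructor
    · rintro ⟨⟨i, hi, hz⟩, h0, h1, hh⟩
      exact ⟨i, hi, hz, h0, h1, hh⟩
    · rintro ⟨i, hi, hz, h0, h1, hh⟩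
      exact ⟨⟨i, hi, hz⟩, h0, h1, hh⟩
  rw [key]
  simp only [Set.iUnion_eq_empty]

/-- THE LOCAL FACTORS OF `ζ`: for every finite set of primes the finite Euler product
`∏_{p ∈ S} (1 − p^{−s})` (the reciprocal of the `S`-local zeta function; all roots `α = 1`,
zeros on `Re s = 0`) has EMPTY bands — the `S`-local layer of a band statement has no zero
content; everything is in the limit `S → ∞`. [folklore] -/
theorem bandSet_zetaLocalFactors_eq_empty (S : Finset ℕ) (hS : ∀ p ∈ S, 1 < p) (ε : ℝ) :
    bandSet (fun s => ∏ p ∈ S, eulerTerm p 1 s) ε = ∅ := by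
  classical
  induction S using Finset.induction_on with
  | empty => simpa using bandSet_one ε
  | insert a S ha ih =>
    have hfun : (fun s => ∏ p ∈ insert a S, eulerTerm p 1 s) =
        fun s => eulerTerm a 1 s * ∏ p ∈ S, eulerTerm p 1 s := by
      funext s
      exact Finset.prod_insert ha
    rw [hfun, bandSet_mul, ih fun p hp => hS p (Finset.mem_insert_of_mem hp),
      bandSet_eulerTerm_eq_empty_of_norm_le_one (hS a (Finset.mem_insert_self a S)) (by simp),
      Set.empty_union]


/-- The `S`-LOCAL ZETA FUNCTION `ζ_S(s) = π^{−s/2} Γ(s/2) ∏_{p ∈ S} (1 − p^{−s})⁻¹` of a finite set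
of places `S ∋ ∞` (the object of the route's foreseen first layer "S-local band realisation";
Connes 1999 Thm 4, Meyer 2005 p. 5). [folklore] -/
def localZeta (S : Finset ℕ) (s : ℂ) : ℂ :=
  (Real.pi : ℂ) ^ (-s / 2) * Complex.Gamma (s / 2) * ∏ p ∈ S, (eulerTerm p 1 s)⁻¹

/-- `ζ_S` has NO zeros in the right half-plane `Re s > 0` (the archimedean factor never vanishes
there and the inverted Euler factors vanish — as Lean junk values of `⁻¹` — only on `Re s = 0`).
[folklore] -/
theorem localZeta_ne_zero (S : Finset ℕ) (hS : ∀ p ∈ S, 1 < p) {s : ℂ} (h0 : 0 < s.re) :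
    localZeta S s ≠ 0 := by
  have hπ : (Real.pi : ℂ) ≠ 0 := ofReal_ne_zero.2 Real.pi_ne_zero
  refine mul_ne_zero (mul_ne_zero ?_ ?_) ?_
  · rw [Ne, cpow_eq_zero_iff, not_and_or]
    exact Or.inl hπ
  · apply Complex.Gamma_ne_zero_of_re_pos
    rw [div_ofNat_re]
    positivity
  · rw [Finset.prod_ne_zero_iff]
    intro p hp
    rw [Ne, inv_eq_zero]
    intro hz
    have hp := hS p hp
    have hp0 : 0 < p := by omega
    have hp1 : (1 : ℝ) < p := by exact_mod_cast hp
    have hn : ‖(1 : ℂ)‖ = (p : ℝ) ^ s.re := norm_eq_rpow_of_eulerTerm_eq_zero hp0 hz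
    rw [norm_one] at hn
    have : (1 : ℝ) < (p : ℝ) ^ s.re := Real.one_lt_rpow hp1 h0
    linarith

/-- Hence EVERY band of `ζ_S` is EMPTY, for every finite `S`: the `S`-local layer of a band
statement has no zero content at all — the whole content of the crux is in the passage `S → ∞`
(uniformity of the constants), where vertical periodicity factor by factor is lost. [folklore] -/
theorem bandSet_localZeta_eq_empty (S : Finset ℕ) (hS : ∀ p ∈ S, 1 < p) (ε : ℝ) :
    bandSet (localZeta S) ε = ∅ := by
  ext s
  simp only [bandSet, mem_setOf_eq, mem_empty_iff_false, iff_false, not_and]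
  intro hz h0 _ _
  exact localZeta_ne_zero S hS h0 hz

end periodic

/-! ## 15. "Almost all" is a theorem; "all but finitely many" is the crux (cycle 4; LANDED as Negative/`AlmostAll`, p81473)

The DENSITY-ONE version of the crux is PROVED in tree: by Ingham (§6e, `countRe_isBigO_of_ingham`)
and Riemann–von Mangoldt (`riemann_von_mangoldt_holds`: `T ≤ N(T)` eventually) the proportion of
the zeros up to height `T` in the band of level `ε` is `O(T^{−2ε/(3−2ε)}) → 0`; by the uniform
Selberg density theorem (PROVED, `selberg_zeroDensity_near_half`) even the SHRINKING band of level
`A log log T / log T` contains almost all zeros. The crux is the EVERYWHERE version — the count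
bounded (`countRe_bounded_of_acl`), not the proportion vanishing; in between nothing is known. -/

section almost_all

open Summit.RiemannHypothesis.RiemannHypothesis.Theorems.AsymptoticCriticalLine.Negative
  (countRe_isBigO_of_ingham)

open Filter Asymptotics
open Literature.NumberTheory.LFunctions (zetaZeroCountRe zetaZeroCount riemann_von_mangoldt_holds
  zetaZeroCountRe_anti_left_holds)

/-- The proportion of the zeros `0 < Im ρ ≤ T` (with multiplicity) lying in the right half-band
`Re ρ ≥ 1/2 + ε`. [folklore] -/
def bandProportion (ε T : ℝ) : ℝ :=
  (zetaZeroCountRe (1 / 2 + ε) T : ℝ) / zetaZeroCount T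

/-- The proportion is at most `1` (`N(σ, T)` is antitone in `σ`). [folklore] -/
theorem bandProportion_le_one {ε : ℝ} (hε : 0 ≤ ε) (T : ℝ) : bandProportion ε T ≤ 1 := by
  unfold bandProportion
  have h : zetaZeroCountRe (1 / 2 + ε) T ≤ zetaZeroCount T :=
    zetaZeroCountRe_anti_left_holds T (by linarith : (0 : ℝ) ≤ 1 / 2 + ε)
  rcases Nat.eq_zero_or_pos (zetaZeroCount T) with h0 | hpos
  · rw [h0, Nat.cast_zero, div_zero]
    exact zero_le_one
  · rw [div_le_one (by exact_mod_cast hpos)]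
    exact_mod_cast h

/-- [folklore] -/
theorem bandProportion_nonneg (ε T : ℝ) : 0 ≤ bandProportion ε T := by
  unfold bandProportion
  positivity

/-- ALMOST ALL ZEROS LIE IN EVERY BAND (Ingham + Riemann–von Mangoldt, both PROVED in tree): the
proportion of zeros up to height `T` with `Re ρ ≥ 1/2 + ε` is `O(T^{−2ε/(3−2ε)})`. [folklore] -/
theorem bandProportion_isBigO_rpow_neg {ε : ℝ} (hε : 0 < ε) (hε' : ε ≤ 1 / 2) :
    (bandProportion ε) =O[atTop] fun T : ℝ => T ^ (-(2 * ε / (3 - 2 * ε))) := by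
  obtain ⟨C, hC, hbd⟩ := (countRe_isBigO_of_ingham hε hε').exists_pos
  refine IsBigO.of_bound C ?_
  filter_upwards [hbd.bound, riemann_von_mangoldt_holds.eventually_self_le,
    eventually_ge_atTop (1 : ℝ)] with T hb hN h1
  have hT : 0 < T := by linarith
  have hNpos : (0 : ℝ) < zetaZeroCount T := by linarith
  rw [Real.norm_of_nonneg (bandProportion_nonneg ε T),
    Real.norm_of_nonneg (Real.rpow_nonneg hT.le _)]
  rw [Real.norm_natCast, Real.norm_of_nonneg (Real.rpow_nonneg hT.le _)] at hb
  unfold bandProportion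
  rw [div_le_iff₀ hNpos]
  have hpow : T ^ (1 - 2 * ε / (3 - 2 * ε)) = T ^ (-(2 * ε / (3 - 2 * ε))) * T := by
    rw [show (1 : ℝ) - 2 * ε / (3 - 2 * ε) = -(2 * ε / (3 - 2 * ε)) + 1 by ring,
      Real.rpow_add hT, Real.rpow_one]
  calc (zetaZeroCountRe (1 / 2 + ε) T : ℝ) ≤ C * T ^ (1 - 2 * ε / (3 - 2 * ε)) := hb
    _ = C * T ^ (-(2 * ε / (3 - 2 * ε))) * T := by rw [hpow, mul_assoc]
    _ ≤ C * T ^ (-(2 * ε / (3 - 2 * ε))) * zetaZeroCount T :=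
        mul_le_mul_of_nonneg_left hN (by positivity)

/-- … hence tends to `0`: for every `ε > 0`, asymptotically 100% of the zeros satisfy
`Re ρ < 1/2 + ε` (and symmetrically `Re ρ > 1/2 − ε`). The crux asks that the EXCEPTIONS be
finitely many, not merely of density zero. [folklore] -/
theorem tendsto_bandProportion_zero {ε : ℝ} (hε : 0 < ε) :
    Tendsto (bandProportion ε) atTop (nhds 0) := by
  by_cases hε' : ε ≤ 1 / 2
  · have hδ : 0 < 2 * ε / (3 - 2 * ε) := by
      have : 0 < 3 - 2 * ε := by linarith
      positivity
    have h0 : Tendsto (fun T : ℝ => T ^ (-(2 * ε / (3 - 2 * ε)))) atTop (nhds 0) :=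
      tendsto_rpow_neg_atTop hδ
    exact (bandProportion_isBigO_rpow_neg hε hε').trans_tendsto h0
  · -- for `ε > 1/2` the band is empty: `N(1/2 + ε, T) = 0` (no zeros with `Re ρ > 1`)
    have hzero : ∀ T, bandProportion ε T = 0 := by
      intro T
      unfold bandProportion
      have : zetaZeroCountRe (1 / 2 + ε) T = 0 := by
        unfold zetaZeroCountRe
        have hemp : Literature.NumberTheory.LFunctions.zetaZeroBox (1 / 2 + ε) T = ∅ := by
          ext ρ
          simp only [Literature.NumberTheory.LFunctions.zetaZeroBox, Set.mem_setOf_eq,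
            Set.mem_empty_iff_false, iff_false, not_and]
          intro _ hσ h1 _ _
          linarith
        rw [hemp, finsum_mem_empty]
        rfl
      rw [this, Nat.cast_zero, zero_div]
    rw [show bandProportion ε = fun _ => 0 from funext hzero]
    exact tendsto_const_nhds

/-! ## Selberg strength: the proved band may even shrink like `log log T / log T` -/

/-- `T^{1 − κη} · log T = T / log T` for `η = (2/κ) log log T / log T` (`T > 1`, `log T > 0`).
[folklore] -/
theorem rpow_shrink_eq {κ T : ℝ} (hκ : κ ≠ 0) (hT : 1 < T) (hlog : 0 < Real.log T) :
    T ^ (1 - κ * (2 / κ * Real.log (Real.log T) / Real.log T)) * Real.log T = T / Real.log T := by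
  have hT0 : 0 < T := by linarith
  have h1 : κ * (2 / κ * Real.log (Real.log T) / Real.log T) = 2 * Real.log (Real.log T) / Real.log T := by
    field_simp
  rw [h1, Real.rpow_def_of_pos hT0]
  have h2 : Real.log T * (1 - 2 * Real.log (Real.log T) / Real.log T) =
      Real.log T - 2 * Real.log (Real.log T) := by
    field_simp
  rw [h2, Real.exp_sub, Real.exp_log hT0, show (2 : ℝ) * Real.log (Real.log T) =
    Real.log (Real.log T) + Real.log (Real.log T) by ring, Real.exp_add, Real.exp_log hlog]
  field_simp

/-- ALMOST ALL ZEROS AT SELBERG'S SCALE (Selberg 1946 Thm 1, PROVED in tree as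
`SelbergDensity.selberg_zeroDensity_near_half`: `N(σ, T) ≤ C T^{1 − κ(σ−1/2)} log T` uniformly in
`1/2 ≤ σ ≤ 1`): with the SHRINKING level `ε(T) = A log log T / log T` (`A = 2/κ`) the proportion of
zeros up to height `T` with `Re ρ ≥ 1/2 + ε(T)` is `≤ C / log T` eventually, hence `→ 0`. So almost
all zeros satisfy `|Re ρ − 1/2| < A log log T / log T`, unconditionally; the crux asks for the
fixed-`ε` band to be FINITE. [cite: Titchmarsh1986, Thm. 9.19 (C)] -/
theorem tendsto_shrinkingBandProportion_zero :
    ∃ A : ℝ, 0 < A ∧ Tendsto (fun T : ℝ =>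
      (zetaZeroCountRe (1 / 2 + A * Real.log (Real.log T) / Real.log T) T : ℝ) / zetaZeroCount T)
      atTop (nhds 0) := by
  obtain ⟨κ, hκ, C, T₀, hD⟩ := Literature.NumberTheory.LFunctions.SelbergDensity.selberg_zeroDensity_near_half
  refine ⟨2 / κ, by positivity, ?_⟩
  -- `log log T / log T → 0`, so the level is eventually in `[0, 1/2]`
  have hsmall : Tendsto (fun T : ℝ => Real.log (Real.log T) / Real.log T) atTop (nhds 0) := by
    have h := Real.isLittleO_log_id_atTop.comp_tendsto Real.tendsto_log_atTop
    simpa using h.tendsto_div_nhds_zero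
  have hlev : ∀ᶠ T : ℝ in atTop, 0 ≤ 2 / κ * Real.log (Real.log T) / Real.log T ∧
      2 / κ * Real.log (Real.log T) / Real.log T ≤ 1 / 2 := by
    have h1 : ∀ᶠ T : ℝ in atTop, Real.log (Real.log T) / Real.log T ≤ κ / 4 :=
      (hsmall.eventually (ge_mem_nhds (by positivity : (0 : ℝ) < κ / 4)))
    have h2 : ∀ᶠ T : ℝ in atTop, Real.exp 1 ≤ T := eventually_ge_atTop _
    filter_upwards [h1, h2] with T h1 h2
    have hT1 : 1 < T := lt_of_lt_of_le (by have := Real.add_one_le_exp (1 : ℝ); linarith) h2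
    have hlogT : 1 ≤ Real.log T := by
      rw [← Real.log_exp 1]
      exact Real.log_le_log (Real.exp_pos 1) h2
    have hll : 0 ≤ Real.log (Real.log T) := Real.log_nonneg hlogT
    constructor
    · positivity
    · rw [mul_div_assoc]
      calc 2 / κ * (Real.log (Real.log T) / Real.log T) ≤ 2 / κ * (κ / 4) :=
            mul_le_mul_of_nonneg_left h1 (by positivity)
        _ = 1 / 2 := by field_simp; ring
  -- the bound `≤ C / log T`, which tends to `0`
  have hbound : ∀ᶠ T : ℝ in atTop,
      (zetaZeroCountRe (1 / 2 + 2 / κ * Real.log (Real.log T) / Real.log T) T : ℝ) / zetaZeroCount T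
        ≤ |C| / Real.log T := by
    filter_upwards [hlev, eventually_ge_atTop T₀, eventually_ge_atTop (Real.exp 1),
      riemann_von_mangoldt_holds.eventually_self_le] with T hlev hT₀ hTe hN
    have hT1 : 1 < T := lt_of_lt_of_le (by have := Real.add_one_le_exp (1 : ℝ); linarith) hTe
    have hT0 : 0 < T := by linarith
    have hlog : 0 < Real.log T := Real.log_pos hT1
    have hNpos : (0 : ℝ) < zetaZeroCount T := by linarith
    have h := hD T hT₀ (1 / 2 + 2 / κ * Real.log (Real.log T) / Real.log T) (by linarith [hlev.1])
      (by linarith [hlev.2])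
    rw [show 1 / 2 + 2 / κ * Real.log (Real.log T) / Real.log T - 1 / 2 =
      2 / κ * Real.log (Real.log T) / Real.log T by ring] at h
    rw [mul_assoc, rpow_shrink_eq hκ.ne' hT1 hlog] at h
    rw [div_le_iff₀ hNpos]
    calc (zetaZeroCountRe (1 / 2 + 2 / κ * Real.log (Real.log T) / Real.log T) T : ℝ)
        ≤ C * (T / Real.log T) := h
      _ ≤ |C| * (T / Real.log T) := mul_le_mul_of_nonneg_right (le_abs_self C) (by positivity)
      _ = |C| / Real.log T * T := by field_simp
      _ ≤ |C| / Real.log T * zetaZeroCount T := mul_le_mul_of_nonneg_left hN (by positivity)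
  have hlim : Tendsto (fun T : ℝ => |C| / Real.log T) atTop (nhds 0) :=
    tendsto_const_nhds.div_atTop Real.tendsto_log_atTop
  refine tendsto_of_tendsto_of_tendsto_of_le_of_le' tendsto_const_nhds hlim ?_ hbound
  filter_upwards with T
  positivity


end almost_all

/-! ## 16. The engine outputs rung #4 and nothing more (cycle 4; LANDED as Negative/`EngineSharp`, p81557)

DIAGONAL GROUPS `T t = diag(e^{t zₙ})` on `ℓ²(ℕ, ℂ)` with `|Re zₙ| ≤ 1`: a group of bounded
operators with the basis vectors as joint eigenvectors; if `Re zₙ → 0` then `T t₀` is unitary +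
compact AT EVERY TIME (`isCompactOperator_diagGroup_sub_phase`, `phaseOp_mem_unitary`). With
`zₙ = 1/(n+2) + in` (`exists_engineModel_infinite_offLine`) the hypotheses of the route's
`BandEngine` hold while the off-line joint eigenvalues are infinitely many, accumulating at the
line: "unitary modulo compact at one time" yields exactly rung #4's shape and is compatible with
the failure of rung #5 and of X (operator-side twin of §6d `not_forall_powerSum_imp_finite`).
The same `diagGroup` over an enumeration `ρₙ − 1/2` of the zeros is the intended witness of the
support `AsymptoticToRealisation`. -/

section engine

open Filter Topology


/-- The Hilbert space `ℓ²(ℕ, ℂ)`. [folklore] -/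
abbrev Ell2 : Type := lp (fun _ : ℕ => ℂ) 2

/-- Its standard Hilbert basis (the identity representation). [folklore] -/
def stdBasis : HilbertBasis ℕ ℂ Ell2 :=
  HilbertBasis.ofRepr (LinearIsometryEquiv.refl ℂ Ell2)

/-- `‖e^{t zₙ}‖ ≤ e^{|t|}` when `|Re zₙ| ≤ 1` (exponent sequences with real parts in `[-1, 1]`, so that
`e^{t zₙ}` is bounded for each `t`). [folklore] -/
theorem norm_exp_mul_le {z : ℕ → ℂ} (hz : ∀ n : ℕ, |(z n).re| ≤ 1) (t : ℝ) (n : ℕ) :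
    ‖exp (t * z n)‖ ≤ Real.exp |t| := by
  rw [norm_exp, Real.exp_le_exp]
  have h1 : ((t : ℂ) * z n).re = t * (z n).re := by simp
  rw [h1]
  calc t * (z n).re ≤ |t * (z n).re| := le_abs_self _
    _ = |t| * |(z n).re| := abs_mul _ _
    _ ≤ |t| * 1 := mul_le_mul_of_nonneg_left (hz n) (abs_nonneg _)
    _ = |t| := mul_one _

/-- The bounded symbol `n ↦ e^{t zₙ}`. [folklore] -/
def expSymbol {z : ℕ → ℂ} (hz : ∀ n : ℕ, |(z n).re| ≤ 1) (t : ℝ) : lp (fun _ : ℕ => ℂ) ⊤ :=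
  ⟨fun n => exp (t * z n), memℓp_infty ⟨Real.exp |t|, by
    rintro _ ⟨n, rfl⟩
    exact norm_exp_mul_le hz t n⟩⟩

/-- [folklore] -/
@[simp] theorem expSymbol_apply {z : ℕ → ℂ} (hz : ∀ n : ℕ, |(z n).re| ≤ 1) (t : ℝ) (n : ℕ) :
    expSymbol hz t n = exp (t * z n) := rfl

/-- THE DIAGONAL GROUP `T t = diag(e^{t zₙ})` on `ℓ²(ℕ, ℂ)`. [folklore] -/
def diagGroup {z : ℕ → ℂ} (hz : ∀ n : ℕ, |(z n).re| ≤ 1) (t : ℝ) : Ell2 →L[ℂ] Ell2 :=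
  stdBasis.diagonalCLM (expSymbol hz t)

/-- `T 0 = id`. [folklore] -/
theorem diagGroup_zero {z : ℕ → ℂ} (hz : ∀ n : ℕ, |(z n).re| ≤ 1) :
    diagGroup hz 0 = ContinuousLinearMap.id ℂ Ell2 := by
  have h : expSymbol hz 0 = 1 := by
    apply lp.ext
    funext n
    rw [lp.infty_coeFn_one, expSymbol_apply]
    simp
  rw [diagGroup, h, HilbertBasis.diagonalCLM_one]
  rfl

/-- The group law `T (s + t) = T s ∘ T t`. [folklore] -/
theorem diagGroup_add {z : ℕ → ℂ} (hz : ∀ n : ℕ, |(z n).re| ≤ 1) (s t : ℝ) :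
    diagGroup hz (s + t) = (diagGroup hz s).comp (diagGroup hz t) := by
  have h : expSymbol hz (s + t) = expSymbol hz s * expSymbol hz t := by
    apply lp.ext
    funext n
    rw [lp.infty_coeFn_mul, Pi.mul_apply, expSymbol_apply, expSymbol_apply, expSymbol_apply,
      ← exp_add]
    push_cast
    ring_nf
  rw [diagGroup, h, HilbertBasis.diagonalCLM_mul]
  rfl

/-- [folklore] -/
theorem stdBasis_ne_zero (n : ℕ) : (stdBasis n : Ell2) ≠ 0 :=
  stdBasis.orthonormal.ne_zero n

/-- JOINT EIGENVECTORS: `T t eₙ = e^{t zₙ} eₙ` for all `t`. [folklore] -/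
theorem diagGroup_basis {z : ℕ → ℂ} (hz : ∀ n : ℕ, |(z n).re| ≤ 1) (t : ℝ) (n : ℕ) :
    diagGroup hz t (stdBasis n) = exp (t * z n) • stdBasis n := by
  rw [diagGroup, HilbertBasis.diagonalCLM_basis, expSymbol_apply]

/-- Every `zₙ` is a joint eigenvalue of the diagonal group. [folklore] -/
theorem range_subset_jointEigenvalues {z : ℕ → ℂ} (hz : ∀ n : ℕ, |(z n).re| ≤ 1) :
    Set.range z ⊆ {w : ℂ | ∃ v : Ell2, v ≠ 0 ∧ ∀ t : ℝ, diagGroup hz t v = exp (↑t * w) • v} := by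
  rintro _ ⟨n, rfl⟩
  exact ⟨stdBasis n, stdBasis_ne_zero n, fun t => diagGroup_basis hz t n⟩

/-! ## Unitary + compact at every time when `Re zₙ → 0` -/

/-- The unit-modulus symbol `n ↦ e^{i t Im zₙ}`. [folklore] -/
def phaseSymbol (z : ℕ → ℂ) (t : ℝ) : lp (fun _ : ℕ => ℂ) ⊤ :=
  ⟨fun n => exp ((t * (z n).im : ℝ) * I), memℓp_infty ⟨1, by
    rintro _ ⟨n, rfl⟩
    simp only [norm_exp_ofReal_mul_I, le_refl]⟩⟩

/-- [folklore] -/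
@[simp] theorem phaseSymbol_apply (z : ℕ → ℂ) (t : ℝ) (n : ℕ) :
    phaseSymbol z t n = exp ((t * (z n).im : ℝ) * I) := rfl

/-- The diagonal unitary `U_t = diag(e^{i t Im zₙ})`. [folklore] -/
def phaseOp (z : ℕ → ℂ) (t : ℝ) : Ell2 →L[ℂ] Ell2 :=
  stdBasis.diagonalCLM (phaseSymbol z t)

/-- `star m * m = 1 = m * star m` for a unit-modulus symbol. [folklore] -/
theorem phaseSymbol_star_mul (z : ℕ → ℂ) (t : ℝ) :
    star (phaseSymbol z t) * phaseSymbol z t = 1 ∧ phaseSymbol z t * star (phaseSymbol z t) = 1 := by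
  have key : ∀ n : ℕ, (starRingEnd ℂ) (phaseSymbol z t n) * phaseSymbol z t n = 1 := by
    intro n
    rw [phaseSymbol_apply, ← exp_conj, ← exp_add, map_mul, conj_ofReal, conj_I]
    ring_nf
    exact exp_zero
  constructor
  · apply lp.ext
    funext n
    rw [lp.infty_coeFn_mul, lp.infty_coeFn_one, Pi.mul_apply, Pi.one_apply, lp.star_apply]
    exact key n
  · apply lp.ext
    funext n
    rw [lp.infty_coeFn_mul, lp.infty_coeFn_one, Pi.mul_apply, Pi.one_apply, lp.star_apply,
      mul_comm]
    exact key n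

/-- `U_t` is unitary. [folklore] -/
theorem phaseOp_mem_unitary (z : ℕ → ℂ) (t : ℝ) :
    phaseOp z t ∈ unitary (Ell2 →L[ℂ] Ell2) := by
  rw [Unitary.mem_iff, ContinuousLinearMap.star_eq_adjoint, phaseOp,
    HilbertBasis.adjoint_diagonalCLM, ← HilbertBasis.diagonalCLM_mul,
    ← HilbertBasis.diagonalCLM_mul, (phaseSymbol_star_mul z t).1, (phaseSymbol_star_mul z t).2,
    HilbertBasis.diagonalCLM_one]
  exact ⟨rfl, rfl⟩

/-- `diag` is additive in the symbol (subtraction). [folklore] -/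
theorem diagonalCLM_sub {ι 𝕜 H : Type*} [RCLike 𝕜] [NormedAddCommGroup H] [InnerProductSpace 𝕜 H]
    (b : HilbertBasis ι 𝕜 H) (m n : lp (fun _ : ι => 𝕜) ⊤) :
    b.diagonalCLM (m - n) = b.diagonalCLM m - b.diagonalCLM n := by
  ext x
  apply b.repr.injective
  ext i
  simp [sub_mul]

/-- The symbol of `T t − U_t` is `e^{i t Im zₙ}(e^{t Re zₙ} − 1)`, of modulus
`|e^{t Re zₙ} − 1|`. [folklore] -/
theorem norm_expSymbol_sub_phaseSymbol {z : ℕ → ℂ} (hz : ∀ n : ℕ, |(z n).re| ≤ 1) (t : ℝ) (n : ℕ) :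
    ‖(expSymbol hz t - phaseSymbol z t) n‖ = |Real.exp (t * (z n).re) - 1| := by
  rw [lp.coeFn_sub, Pi.sub_apply, expSymbol_apply, phaseSymbol_apply]
  have hsplit : (t : ℂ) * z n = ((t * (z n).re : ℝ) : ℂ) + ((t * (z n).im : ℝ) : ℂ) * I := by
    conv_lhs => rw [← re_add_im (z n)]
    push_cast
    ring
  rw [hsplit, exp_add, ← sub_one_mul, norm_mul, norm_exp_ofReal_mul_I, mul_one, ← ofReal_exp,
    ← ofReal_one, ← ofReal_sub, norm_real, Real.norm_eq_abs]

/-- UNITARY + COMPACT AT EVERY TIME: if `Re zₙ → 0` then `T t − U_t` is compact for every `t`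
(its symbol tends to `0`). [folklore] -/
theorem isCompactOperator_diagGroup_sub_phase {z : ℕ → ℂ} (hz : ∀ n : ℕ, |(z n).re| ≤ 1)
    (h : Tendsto (fun n => (z n).re) atTop (𝓝 0)) (t : ℝ) :
    IsCompactOperator (diagGroup hz t - phaseOp z t) := by
  rw [diagGroup, phaseOp, ← diagonalCLM_sub]
  apply stdBasis.isCompactOperator_diagonalCLM_of_tendsto_zero
  rw [Nat.cofinite_eq_atTop]
  have h1 : Tendsto (fun n => Real.exp (t * (z n).re) - 1) atTop (𝓝 0) := by
    have := ((Real.continuous_exp.tendsto _).comp (h.const_mul t))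
    rw [mul_zero, Real.exp_zero] at this
    simpa using this.sub_const 1
  have h2 : Tendsto (fun n => |Real.exp (t * (z n).re) - 1|) atTop (𝓝 0) := by
    simpa using h1.abs
  refine h2.congr fun n => ?_
  rw [norm_expSymbol_sub_phaseSymbol]

/-! ## The model: joint eigenvalues `zₙ = 1/(n+2) + in`, all off the line -/

/-- The exponents of the model. [folklore] -/
def modelExp (n : ℕ) : ℂ :=
  ((1 / ((n : ℝ) + 2) : ℝ) : ℂ) + n * I

/-- [folklore] -/
theorem modelExp_re (n : ℕ) : (modelExp n).re = 1 / ((n : ℝ) + 2) := by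
  simp only [modelExp, add_re, ofReal_re, mul_re, natCast_re, I_re, mul_zero, natCast_im, I_im,
    mul_one, sub_self, add_zero]

/-- [folklore] -/
theorem modelExp_im (n : ℕ) : (modelExp n).im = n := by
  simp only [modelExp, add_im, ofReal_im, mul_im, natCast_re, I_im, mul_one, natCast_im, I_re,
    mul_zero, add_zero, zero_add]

/-- [folklore] -/
theorem modelExp_bddRe : ∀ n : ℕ, |(modelExp n).re| ≤ 1 := by
  intro n
  rw [modelExp_re, abs_of_pos (by positivity)]
  rw [div_le_one (by positivity)]
  have : (0 : ℝ) ≤ n := n.cast_nonneg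
  linarith

/-- [folklore] -/
theorem modelExp_re_pos (n : ℕ) : 0 < (modelExp n).re := by
  rw [modelExp_re]; positivity

/-- The real parts tend to `0`: the joint eigenvalues ACCUMULATE AT THE LINE from off it. [folklore] -/
theorem tendsto_modelExp_re : Tendsto (fun n => (modelExp n).re) atTop (𝓝 0) := by
  simp only [modelExp_re]
  have h : Tendsto (fun n : ℕ => (n : ℝ) + 2) atTop atTop :=
    tendsto_atTop_add_const_right _ _ tendsto_natCast_atTop_atTop
  exact tendsto_const_nhds.div_atTop h

/-- [folklore] -/
theorem modelExp_injective : Function.Injective modelExp := by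
  intro a b hab
  have h := congrArg Complex.im hab
  rw [modelExp_im, modelExp_im] at h
  exact_mod_cast h

/-- ENGINE SHARPNESS. A complex Hilbert space with a one-parameter group of bounded operators that
is unitary + compact at EVERY time `t₀ > 0` (in particular the hypotheses of `BandEngine` hold),
whose off-line joint eigenvalues (`Re z ≠ 0`) are nevertheless INFINITELY MANY (and accumulate
at the line `Re z = 0`). The conclusion of `BandEngine` — finitely many joint eigenvalues with
`|Re z| ≥ ε`, for each `ε > 0`: rung #4's shape — therefore cannot be strengthened to rung #5's
shape ("finitely many off-line joint eigenvalues") from the same hypotheses. [folklore] -/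
theorem exists_engineModel_infinite_offLine :
    ∃ (H : Type) (_ : NormedAddCommGroup H) (_ : InnerProductSpace ℂ H) (_ : CompleteSpace H)
      (T : ℝ → H →L[ℂ] H),
      T 0 = ContinuousLinearMap.id ℂ H ∧ (∀ s t : ℝ, T (s + t) = (T s).comp (T t)) ∧
      (∀ t₀ : ℝ, 0 < t₀ → ∃ U : H →L[ℂ] H, U ∈ unitary (H →L[ℂ] H) ∧ IsCompactOperator (T t₀ - U)) ∧
      {z : ℂ | z.re ≠ 0 ∧ ∃ v : H, v ≠ 0 ∧ ∀ t : ℝ, T t v = exp (↑t * z) • v}.Infinite := by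
  refine ⟨Ell2, inferInstance, inferInstance, inferInstance, diagGroup modelExp_bddRe,
    diagGroup_zero _, diagGroup_add _, fun t₀ _ => ⟨phaseOp modelExp t₀, phaseOp_mem_unitary _ _,
      isCompactOperator_diagGroup_sub_phase _ tendsto_modelExp_re t₀⟩, ?_⟩
  have hsub : Set.range modelExp ⊆
      {z : ℂ | z.re ≠ 0 ∧ ∃ v : Ell2, v ≠ 0 ∧ ∀ t : ℝ, diagGroup modelExp_bddRe t v = exp (↑t * z) • v} := by
    rintro w hw
    obtain ⟨n, rfl⟩ := hw
    exact ⟨(modelExp_re_pos n).ne', range_subset_jointEigenvalues modelExp_bddRe ⟨n, rfl⟩⟩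
  exact (Set.infinite_range_of_injective modelExp_injective).mono hsub

/-- The same model in the shape of `BandEngine`'s third hypothesis (∃ t₀ > 0 …). [folklore] -/
theorem exists_engineModel_infinite_offLine' :
    ∃ (H : Type) (_ : NormedAddCommGroup H) (_ : InnerProductSpace ℂ H) (_ : CompleteSpace H)
      (T : ℝ → H →L[ℂ] H),
      T 0 = ContinuousLinearMap.id ℂ H ∧ (∀ s t : ℝ, T (s + t) = (T s).comp (T t)) ∧
      (∃ t₀ : ℝ, 0 < t₀ ∧ ∃ U : H →L[ℂ] H, U ∈ unitary (H →L[ℂ] H) ∧ IsCompactOperator (T t₀ - U)) ∧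
      {z : ℂ | z.re ≠ 0 ∧ ∃ v : H, v ≠ 0 ∧ ∀ t : ℝ, T t v = exp (↑t * z) • v}.Infinite := by
  obtain ⟨H, i1, i2, i3, T, h0, hadd, hUK, hinf⟩ := exists_engineModel_infinite_offLine
  exact ⟨H, i1, i2, i3, T, h0, hadd, ⟨1, one_pos, hUK 1 one_pos⟩, hinf⟩


end engine

end Summit.RiemannHypothesis.RiemannHypothesis.Cruxes.AsymptoticCriticalLine.Disproof
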